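import Mathlib
import HarnessLib
import Summits.ABC.ABC.Theorems.SoloBlindShapeBKnown
import Literature.NumberTheory.DiophantineGeometry.MultiplicativeGroupApproximationOfMatveevYu
import Literature.NumberTheory.DiophantineGeometry.XYZConjecture

/-!
# `ω = 3` prelude: Matveev's bound for two and three NATURAL logarithms, inversion lemmas, small tools

`Summits/ABC/ABC/Theorems/SoloBlindOmega3Prelude.lean`; namespace `Summit.ABC.ABC.Theorems`
(solo seat `solo-ABC-blind`, wall coordinate C1⁗(1); preliminaries shared by `SoloBlindShapeAKnown`,
`SoloBlindShapeCDKnown`, `SoloBlindOmega3Leaves`, `SoloBlindOmega3Known`).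

* `matveev_height_nat` : for `n ≥ 2`, `max (h(n), |log n|, 0.16) = log n` (`h = logHeight₁` on `ℚ`);
* `matveev_two_nat`, `matveev_three_nat` : the tree's named fact
  `Literature.NumberTheory.DiophantineGeometry.Dioph.matveev2000_linearFormsLog_rat` (Matveev 2000 over `ℚ`,
  as printed in Evertse–Győry 2015, Thm 3.2.4) specialised to `Λ = b₁ log x + b₂ log y (+ b₃ log z)` with
  natural `x, y, z ≥ 2`: `log |Λ| > −2³² · log x · log y · (1 + log B)` resp. `−2³⁸ · log x log y log z · (1 + log B)`
  (the fact's constant `min(…, 2^{6n+20})` at `n = 2, 3`);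
* `le_of_lt_mul_log_succ_gen`, `le_of_lt_mul_log_succ` : real-variable inversion of
  `L < K · Q · (1 + log (L + 1))` to `L ≤ K′ · Q · (1 + log log-type)` for the constants used downstream;
* `log_ten_pow_twelve_lt`, `log_ten_pow_thirteen_lt`, `neg_mul_mul_lt_mono`;
* `loglog_*` (with `one_lt_log_of_three_le` of `Literature/…/XYZConjecture`), `eq_prime_pow_pos` (a number divisible by the prime `r` and by
  no other prime is `r^e`, `e ≥ 1`), `omega3_absorb` (absorbing the shape constants into `10¹³`).

Trust base: the Matveev named fact, as a hypothesis where it occurs; everything else is proved. [folklore]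
-/

noncomputable section

namespace Summit.ABC.ABC.Theorems

open Real Height Literature.NumberTheory.Transcendental Literature.NumberTheory.DiophantineGeometry
  Literature.NumberTheory.DiophantineGeometry.Dioph

/-- `log 10¹² < 28` (`e²⁸ > 1.4 · 10¹²`). [folklore] -/
theorem log_ten_pow_twelve_lt : Real.log ((10 : ℝ) ^ 12) < 28 := by
  have h := Real.exp_one_gt_d9
  have h28 : (2.7182818283 : ℝ) ^ 28 < Real.exp 1 ^ 28 :=
    pow_lt_pow_left₀ h (by norm_num) (by norm_num)
  rw [← Real.exp_nat_mul] at h28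
  norm_num at h28
  have h10 : (10 : ℝ) ^ 12 < Real.exp 28 := lt_of_lt_of_le (by norm_num) h28.le
  calc Real.log ((10 : ℝ) ^ 12) < Real.log (Real.exp 28) :=
        Real.log_lt_log (by positivity) h10
    _ = 28 := Real.log_exp 28

/-- The real-variable inversion behind every archimedean regime: if `K (1.7 + c) ≤ K'`,
`log K' ≤ c`, `c ≥ 1.3`, then for `L, Q ≥ 1`, `L < K · Q · (1 + log (L + 1))` forces
`L ≤ K' · Q · (1 + log Q)`.  (Write `L = K' v Q (1 + log Q)`; if `v > 1` then
`1 + log (L + 1) ≤ 0.7 + c + 2 log Q + v` and the hypothesis gives `K' v ≤ K (0.7 + c + v)`.) [folklore] -/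
theorem le_of_lt_mul_log_succ_gen {K K' c L Q : ℝ} (hK : 0 < K) (hc : (1.3 : ℝ) ≤ c)
    (hcK' : Real.log K' ≤ c) (hKK' : K * (1.7 + c) ≤ K') (hL : 1 ≤ L) (hQ : 1 ≤ Q)
    (h : L < K * Q * (1 + Real.log (L + 1))) :
    L ≤ K' * Q * (1 + Real.log Q) := by
  by_contra hcon
  push Not at hcon
  have hK'pos : 0 < K' := by nlinarith
  have hlogQ : 0 ≤ Real.log Q := Real.log_nonneg hQ
  obtain ⟨W, hW⟩ : ∃ W : ℝ, W = Q * (1 + Real.log Q) := ⟨_, rfl⟩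
  have hQW : Q ≤ W := by rw [hW]; nlinarith
  have hW0 : 0 < W := by linarith
  -- log W ≤ 2 log Q
  have hlogW : Real.log W ≤ 2 * Real.log Q := by
    have h1 : 1 + Real.log Q ≤ Q := by
      have := Real.log_le_sub_one_of_pos (by linarith : (0:ℝ) < Q); linarith
    have h2 : Real.log (1 + Real.log Q) ≤ Real.log Q :=
      Real.log_le_log (by linarith) h1
    rw [hW, Real.log_mul (by linarith) (by linarith)]
    linarith
  -- L = K' · v · W with v > 1
  obtain ⟨v, hv⟩ : ∃ v : ℝ, v = L / (K' * W) := ⟨_, rfl⟩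
  have hLv : L = K' * v * W := by rw [hv]; field_simp
  have hv1 : 1 < v := by
    rw [hv, lt_div_iff₀ (by positivity), hW]; linarith
  have hv0 : 0 < v := by linarith
  have hlogv : Real.log v ≤ v - 1 := Real.log_le_sub_one_of_pos hv0
  have hlog2 : Real.log 2 < 0.6931471808 := Real.log_two_lt_d9
  -- log (L + 1) ≤ log 2 + log K' + log v + log W
  have hL1 : Real.log (L + 1) ≤ Real.log 2 + Real.log K' + Real.log v + Real.log W := by
    have h2L : L + 1 ≤ 2 * L := by linarith
    have e := Real.log_le_log (by linarith) h2L
    have e2 : Real.log (2 * L) = Real.log 2 + Real.log K' + Real.log v + Real.log W := by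
      rw [hLv, Real.log_mul (by norm_num) (by positivity), Real.log_mul (by positivity) hW0.ne',
        Real.log_mul hK'pos.ne' hv0.ne']
      ring
    linarith
  have hB : 1 + Real.log (L + 1) ≤ (0.7 + c) + 2 * Real.log Q + v := by linarith
  -- L < K Q (0.7 + c + 2 log Q + v) ≤ K W (0.7 + c + v)
  have h1 : L ≤ K * Q * ((0.7 + c) + 2 * Real.log Q + v) :=
    h.le.trans (mul_le_mul_of_nonneg_left hB (by positivity))
  have h2 : Q * ((0.7 + c) + 2 * Real.log Q + v) ≤ W * ((0.7 + c) + v) := by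
    rw [hW, mul_assoc]
    apply mul_le_mul_of_nonneg_left _ (by linarith)
    nlinarith
  have h3 : K' * v * W ≤ K * ((0.7 + c) + v) * W := by
    calc K' * v * W = L := hLv.symm
      _ ≤ K * Q * ((0.7 + c) + 2 * Real.log Q + v) := h1
      _ = K * (Q * ((0.7 + c) + 2 * Real.log Q + v)) := by ring
      _ ≤ K * (W * ((0.7 + c) + v)) := mul_le_mul_of_nonneg_left h2 hK.le
      _ = K * ((0.7 + c) + v) * W := by ring
  have h4 : K' * v ≤ K * ((0.7 + c) + v) := le_of_mul_le_mul_right h3 hW0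
  have h5 : K * (1.7 + c) * v ≤ K * ((0.7 + c) + v) :=
    (mul_le_mul_of_nonneg_right hKK' hv0.le).trans h4
  have h6 : 0 < K * ((0.7 + c) * (v - 1)) := mul_pos hK (mul_pos (by linarith) (by linarith))
  nlinarith [h5, h6]

/-- The instance used for two logarithms (`C(2) ≤ 2³²`, halved linear form): for `L, Q ≥ 1`,
`L < 2³³ · Q · (1 + log (L + 1))` forces `L ≤ 10¹² · Q · (1 + log Q)`. [folklore] -/
theorem le_of_lt_mul_log_succ {L Q : ℝ} (hL : 1 ≤ L) (hQ : 1 ≤ Q)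
    (h : L < 2 ^ 33 * Q * (1 + Real.log (L + 1))) :
    L ≤ 10 ^ 12 * Q * (1 + Real.log Q) :=
  le_of_lt_mul_log_succ_gen (K := 2 ^ 33) (c := 28) (by norm_num) (by norm_num)
    log_ten_pow_twelve_lt.le (by norm_num) hL hQ h

/-- `h(n) = log n` and the Matveev height normalisation for a natural number `n ≥ 2`. [folklore] -/
theorem matveev_height_nat {n : ℕ} (hn : 2 ≤ n) :
    max (logHeight₁ (n : ℚ)) (max |Real.log ((n : ℚ) : ℝ)| 0.16) ≤ Real.log n := by
  have hn1 : 1 ≤ n := by omega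
  have hlog : 0.6931471803 < Real.log n := by
    have h2 : Real.log 2 ≤ Real.log n := Real.log_le_log (by norm_num) (by exact_mod_cast hn)
    have := Real.log_two_gt_d9
    linarith
  have hh : logHeight₁ (n : ℚ) = Real.log n := by
    rw [Rat.logHeight₁_eq_log_max]
    have hnum : ((n : ℚ)).num = n := by simp
    have hden : ((n : ℚ)).den = 1 := by simp
    rw [hnum, hden]
    simp [hn1]
  rw [hh, Rat.cast_natCast, abs_of_pos (by linarith)]
  refine max_le le_rfl (max_le le_rfl ?_)
  linarith

/-- An auxiliary monotonicity step: `-C·P·L < R`, `C ≤ C'`, `P, L ≥ 0` give `-C'·P·L < R`. [folklore] -/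
theorem neg_mul_mul_lt_mono {C C' P L R : ℝ} (h : -(C * P * L) < R) (hC : C ≤ C') (hP : 0 ≤ P)
    (hL : 0 ≤ L) : -(C' * P * L) < R := by
  have : C * (P * L) ≤ C' * (P * L) := mul_le_mul_of_nonneg_right hC (mul_nonneg hP hL)
  nlinarith

/-- **Matveev for two logarithms of natural numbers** (from the tree's named fact
`matveev2000_linearFormsLog_rat`, `n = 2`, `C(2) ≤ 2³²`).  For `x, y ≥ 2`, `b₂ ≠ 0`,
`Λ = b₁ log x + b₂ log y ≠ 0` and `B ≥ max(1, |b₁|, |b₂| log y / log x)`: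
`log |Λ| > −2³² · log x · log y · (1 + log B)`. [folklore] -/
theorem matveev_two_nat (hM : matveev2000_linearFormsLog_rat) {x y : ℕ} (hx : 2 ≤ x) (hy : 2 ≤ y)
    {b₁ b₂ : ℤ} (hb₂ : b₂ ≠ 0)
    (hΛ : (b₁ : ℝ) * Real.log x + b₂ * Real.log y ≠ 0) {B : ℝ} (hB1 : 1 ≤ B)
    (hBb₁ : |(b₁ : ℝ)| ≤ B) (hBb₂ : |(b₂ : ℝ)| * Real.log y ≤ B * Real.log x) :
    -(2 ^ 32 * (Real.log x * Real.log y) * (1 + Real.log B)) <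
      Real.log |(b₁ : ℝ) * Real.log x + b₂ * Real.log y| := by
  have hX0 : 0 < Real.log x := Real.log_pos (by exact_mod_cast hx)
  have hY0 : 0 < Real.log y := Real.log_pos (by exact_mod_cast hy)
  have hx1 : 1 ≤ x := by omega
  have hy1 : 1 ≤ y := by omega
  have hxQ : (0 : ℚ) < x ∧ (x : ℚ) ≠ 1 :=
    ⟨by exact_mod_cast (by omega : 0 < x), by exact_mod_cast (by omega : x ≠ 1)⟩
  have hyQ : (0 : ℚ) < y ∧ (y : ℚ) ≠ 1 :=
    ⟨by exact_mod_cast (by omega : 0 < y), by exact_mod_cast (by omega : y ≠ 1)⟩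
  have hC : min (Real.exp 1 * (Fintype.card (Fin 2) : ℝ) / 2 * 30 ^ (Fintype.card (Fin 2) + 3) *
        (Fintype.card (Fin 2) : ℝ) ^ (7 / 2 : ℝ)) (2 ^ (6 * Fintype.card (Fin 2) + 20)) ≤ (2 : ℝ) ^ 32 :=
    (min_le_right _ _).trans_eq (by norm_num [Fintype.card_fin])
  have key := hM (Fin 2) (by simp) ![(x : ℚ), (y : ℚ)] ![b₁, b₂] ![Real.log x, Real.log y] 0 B
    (by
      intro k
      fin_cases k
      · simpa using hxQ
      · simpa using hyQ)
    (by
      intro hb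
      have := congrFun hb 1
      simp at this
      exact hb₂ this)
    (by simpa [Fin.sum_univ_two] using hΛ)
    (by
      intro k
      fin_cases k
      · simpa using matveev_height_nat hx
      · simpa using matveev_height_nat hy)
    hB1
    (by
      intro k
      fin_cases k
      · simp
        rw [mul_div_assoc, div_self hX0.ne', mul_one]
        exact hBb₁
      · simp
        rw [div_le_iff₀ hX0]
        exact hBb₂)
  have hlogEB : Real.log (Real.exp 1 * B) = 1 + Real.log B := by
    rw [Real.log_mul (Real.exp_pos 1).ne' (by linarith), Real.log_exp]
  have hL0 : 0 ≤ Real.log (Real.exp 1 * B) := by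
    rw [hlogEB]; have := Real.log_nonneg hB1; linarith
  have hP0 : 0 ≤ ∏ k, (![Real.log x, Real.log y] : Fin 2 → ℝ) k := by
    simp [Fin.prod_univ_two]; positivity
  have key2 := neg_mul_mul_lt_mono key hC hP0 hL0
  have key3 : -((2 : ℝ) ^ 32 * (Real.log x * Real.log y) * Real.log (Real.exp 1 * B)) <
      Real.log |(b₁ : ℝ) * Real.log x + b₂ * Real.log y| := by
    simpa [Fin.sum_univ_two, Fin.prod_univ_two] using key2
  rw [hlogEB] at key3
  linarith


/-- `log 10¹³ < 30` (`e³⁰ > 1.06 · 10¹³`). [folklore] -/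
theorem log_ten_pow_thirteen_lt : Real.log ((10 : ℝ) ^ 13) < 30 := by
  have h := Real.exp_one_gt_d9
  have h30 : (2.7182818283 : ℝ) ^ 30 < Real.exp 1 ^ 30 :=
    pow_lt_pow_left₀ h (by norm_num) (by norm_num)
  rw [← Real.exp_nat_mul] at h30
  norm_num at h30
  have h10 : (10 : ℝ) ^ 13 < Real.exp 30 := lt_of_lt_of_le (by norm_num) h30.le
  calc Real.log ((10 : ℝ) ^ 13) < Real.log (Real.exp 30) :=
        Real.log_lt_log (by positivity) h10
    _ = 30 := Real.log_exp 30

/-- **Matveev for three logarithms of natural numbers** (from the tree's named fact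
`matveev2000_linearFormsLog_rat`, `n = 3`, `C(3) ≤ 2³⁸`).  For `x, y, z ≥ 2`, `b₃ ≠ 0`,
`Λ = b₁ log x + b₂ log y + b₃ log z ≠ 0` and `B ≥ 1` with `|b₁| log x, |b₂| log y ≤ B log z`, `|b₃| ≤ B`:
`log |Λ| > −2³⁸ · log x · log y · log z · (1 + log B)`. [folklore] -/
theorem matveev_three_nat (hM : matveev2000_linearFormsLog_rat) {x y z : ℕ} (hx : 2 ≤ x) (hy : 2 ≤ y)
    (hz : 2 ≤ z) {b₁ b₂ b₃ : ℤ} (hb₃ : b₃ ≠ 0)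
    (hΛ : (b₁ : ℝ) * Real.log x + b₂ * Real.log y + b₃ * Real.log z ≠ 0) {B : ℝ} (hB1 : 1 ≤ B)
    (hBb₁ : |(b₁ : ℝ)| * Real.log x ≤ B * Real.log z) (hBb₂ : |(b₂ : ℝ)| * Real.log y ≤ B * Real.log z)
    (hBb₃ : |(b₃ : ℝ)| ≤ B) :
    -(2 ^ 38 * (Real.log x * Real.log y * Real.log z) * (1 + Real.log B)) <
      Real.log |(b₁ : ℝ) * Real.log x + b₂ * Real.log y + b₃ * Real.log z| := by
  have hX0 : 0 < Real.log x := Real.log_pos (by exact_mod_cast hx)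
  have hY0 : 0 < Real.log y := Real.log_pos (by exact_mod_cast hy)
  have hZ0 : 0 < Real.log z := Real.log_pos (by exact_mod_cast hz)
  have hxQ : (0 : ℚ) < x ∧ (x : ℚ) ≠ 1 :=
    ⟨by exact_mod_cast (by omega : 0 < x), by exact_mod_cast (by omega : x ≠ 1)⟩
  have hyQ : (0 : ℚ) < y ∧ (y : ℚ) ≠ 1 :=
    ⟨by exact_mod_cast (by omega : 0 < y), by exact_mod_cast (by omega : y ≠ 1)⟩
  have hzQ : (0 : ℚ) < z ∧ (z : ℚ) ≠ 1 :=
    ⟨by exact_mod_cast (by omega : 0 < z), by exact_mod_cast (by omega : z ≠ 1)⟩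
  have hC : min (Real.exp 1 * (Fintype.card (Fin 3) : ℝ) / 2 * 30 ^ (Fintype.card (Fin 3) + 3) *
        (Fintype.card (Fin 3) : ℝ) ^ (7 / 2 : ℝ)) (2 ^ (6 * Fintype.card (Fin 3) + 20)) ≤ (2 : ℝ) ^ 38 :=
    (min_le_right _ _).trans_eq (by norm_num [Fintype.card_fin])
  have key := hM (Fin 3) (by simp) ![(x : ℚ), (y : ℚ), (z : ℚ)] ![b₁, b₂, b₃]
    ![Real.log x, Real.log y, Real.log z] 2 B
    (by
      intro k
      fin_cases k
      · simpa using hxQ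
      · simpa using hyQ
      · simpa using hzQ)
    (by
      intro hb
      have := congrFun hb 2
      simp at this
      exact hb₃ this)
    (by simpa [Fin.sum_univ_three] using hΛ)
    (by
      intro k
      fin_cases k
      · simpa using matveev_height_nat hx
      · simpa using matveev_height_nat hy
      · simpa using matveev_height_nat hz)
    hB1
    (by
      intro k
      fin_cases k
      · simp
        rw [div_le_iff₀ hZ0]
        exact hBb₁
      · simp
        rw [div_le_iff₀ hZ0]
        exact hBb₂
      · simp
        rw [mul_div_assoc, div_self hZ0.ne', mul_one]
        exact hBb₃)
  have hlogEB : Real.log (Real.exp 1 * B) = 1 + Real.log B := by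
    rw [Real.log_mul (Real.exp_pos 1).ne' (by linarith), Real.log_exp]
  have hL0 : 0 ≤ Real.log (Real.exp 1 * B) := by
    rw [hlogEB]; have := Real.log_nonneg hB1; linarith
  have hP0 : 0 ≤ ∏ k, (![Real.log x, Real.log y, Real.log z] : Fin 3 → ℝ) k := by
    simp [Fin.prod_univ_three]; positivity
  have key2 := neg_mul_mul_lt_mono key hC hP0 hL0
  have key3 : -((2 : ℝ) ^ 38 * (Real.log x * Real.log y * Real.log z) * Real.log (Real.exp 1 * B)) <
      Real.log |(b₁ : ℝ) * Real.log x + b₂ * Real.log y + b₃ * Real.log z| := by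
    simpa [Fin.sum_univ_three, Fin.prod_univ_three, mul_assoc] using key2
  rw [hlogEB] at key3
  linarith


/-- `p ≥ 3 ⟹ log log p ≥ 0`. [folklore] -/
theorem loglog_nonneg_of_three_le {p : ℕ} (hp : 3 ≤ p) : 0 ≤ Real.log (Real.log p) :=
  Real.log_nonneg (one_lt_log_of_three_le hp).le

/-- `log log p ≤ log log max(p, q)` (`p ≥ 3`). [folklore] -/
theorem loglog_le_loglog_max_left {p q : ℕ} (hp : 3 ≤ p) :
    Real.log (Real.log p) ≤ Real.log (Real.log (max (p : ℝ) q)) := by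
  have hP := one_lt_log_of_three_le hp
  have hp0 : (0 : ℝ) < p := by exact_mod_cast (by omega : 0 < p)
  exact Real.log_le_log (by linarith) (Real.log_le_log hp0 (le_max_left _ _))

/-- `log log q ≤ log log max(p, q)` (`q ≥ 3`). [folklore] -/
theorem loglog_le_loglog_max_right {p q : ℕ} (hq : 3 ≤ q) :
    Real.log (Real.log q) ≤ Real.log (Real.log (max (p : ℝ) q)) := by
  rw [max_comm]; exact loglog_le_loglog_max_left hq

/-- A positive integer divisible by the prime `r` and by no other prime is a positive power of `r`.
[folklore] -/
theorem eq_prime_pow_pos {n r : ℕ} (hr : r.Prime) (hn : n ≠ 0) (hrn : r ∣ n)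
    (h : ∀ {d : ℕ}, d.Prime → d ∣ n → d = r) : ∃ e, 0 < e ∧ n = r ^ e := by
  refine ⟨n.primeFactorsList.length, ?_, Nat.eq_prime_pow_of_unique_prime_dvd hn h⟩
  rcases Nat.eq_zero_or_pos n.primeFactorsList.length with h0 | hpos
  · exfalso
    have hn1 := Nat.eq_prime_pow_of_unique_prime_dvd hn h
    rw [h0, pow_zero] at hn1
    rw [hn1] at hrn
    exact hr.one_lt.ne' (Nat.dvd_one.mp hrn)
  · exact hpos

/-- Absorption of each shape's bound into the uniform one:
`X ≤ K·P·Q·(1+M) + log 2`, `K ≤ 10¹³`, `0 ≤ M ≤ L`, `P, Q ≥ 1` ⟹ `X ≤ 10¹³·P·Q·(1+L) + log 2`. [folklore] -/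
theorem omega3_absorb {P Q M L X K : ℝ} (hP : 1 ≤ P) (hQ : 1 ≤ Q) (hM0 : 0 ≤ M) (hML : M ≤ L)
    (hK' : K ≤ 10 ^ 13) (hX : X ≤ K * P * Q * (1 + M) + Real.log 2) :
    X ≤ 10 ^ 13 * P * Q * (1 + L) + Real.log 2 := by
  have hP0 : 0 ≤ P := by linarith
  have hQ0 : 0 ≤ Q := by linarith
  have hPQ0 : 0 ≤ P * Q := mul_nonneg hP0 hQ0
  have hW : 0 ≤ P * Q * (1 + M) := mul_nonneg hPQ0 (by linarith)
  have h1 : K * (P * Q * (1 + M)) ≤ 10 ^ 13 * (P * Q * (1 + M)) :=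
    mul_le_mul_of_nonneg_right hK' hW
  have h2 : P * Q * M ≤ P * Q * L := mul_le_mul_of_nonneg_left hML hPQ0
  nlinarith [h1, h2]

end Summit.ABC.ABC.Theorems

end
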